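import Summits.Ventures.LatticeQCDFlow.Scaling.DominatedStarSeparation
import Summits.Ventures.LatticeQCDFlow.Scaling.DominatedStarGapAndMixing

/-!
HONEST FRAMING: exact (Metropolis-corrected) sampling algorithms for lattice gauge theory; figures
of merit are autocorrelation/cost numbers at stated couplings and volumes; no continuum-physics
claim.

# DominatedStarTimeAverages — THE MAP-ASSISTED HOT-REFRESHED HUB UNDER ONE-SIDED DOMINATION IS IRREDUCIBLE, ITS
# VARIATIONAL SPECTRAL GAP IS `≥ tcp/(2m)`, AND THE LEVIN–PERES–WILMER SAMPLE-SIZE RULE READS: A BURN-IN OF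
# `⌈(2m/(tcp))·log(2(2K+p)/(pε))⌉` STEPS AND `N ≥ (8m·Var_π̃(f))/(tcp·η²ε)` SAMPLES ESTIMATE `E_π̃(f)` TO `±η` WITH
# PROBABILITY `≥ 1 − ε` FROM EVERY START (lean-2 GEN-26, ours)

Venture-side (OURS).  Cell `lqcd-flow` (pub-lqcd), unit `pub-lqcd-lean-2-g26`, 2026-08-27.  Chapter M (the
coupon-collector ceiling without perfect transports), file 14 — the instrumentable consequence.  Setting of
`Scaling/DominatedStarMixingCeiling` with `μ_k`-reversible cold kernels (so the scheme `P = t·GSw + (1−t)·Π_w^M` is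
`π̃`-reversible, `π̃ = ⊗μ_k`): hub list `e_r = (0, κ_r+1)` of length `m`, multiplicities `≥ c ≥ 1`, bijections `φ_r`,
exact hot sampler, one-sided domination `p·μ_{l_r}(φ_r u) ≤ μ_0(u)` (`0 < p ≤ 1`), regime `4t ≤ p(1−t)w_0`, `0 < t`.

## What is proved

* §0 (any finite chain) **`isIrreducible_of_kernelAt_pos`** — a time `n` with `Pⁿ(x,z) > 0` for all `x, z` makes `P`
  irreducible (`kernelAt = matrix power`, from the tree).
* §1 **`dominatedStar_isIrreducible`** — the scheme is irreducible (the separation minorisation of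
  `Scaling/DominatedStarSeparation` is eventually positive); **`dominatedStar_spectralGap_ge`** (`|S| ≥ 2`) — the
  variational gap `γ = 1 − λ₂ ≥ γ⋆ ≥ tcp/(2m)` (`ReversibleSpectrumReal.absSpectralGap_le_spectralGap` with
  `Scaling/DominatedStarGapAndMixing`); `dominatedStar_spectralGap_inv_le` — `γ⁻¹ ≤ 2m/(tcp)`.
* §2 **`dominatedStar_timeAverage` (THE SAMPLE-SIZE RULE)** — `|S| ≥ 2`, `f` any observable of the configuration,
  `ε, η > 0`: if the burn-in `r ≥ ⌈(2m/(tcp))·log((2K+p)/(p·(ε/2)))⌉` and the sample size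
  `N ≥ (4Var_π̃(f)/(η²ε))·(2m/(tcp))`, `N ≥ 1`, then from EVERY start `x`,
  **`P_x{|N⁻¹ Σ_{s<N} f(X_{r+s}) − E_π̃(f)| ≥ η} ≤ ε`** (Levin–Peres–Wilmer Theorem 12.21 from the tree, fed with
  the mixing ceiling of chapter M for the burn-in and the gap floor for the variance).

Reading (no numerics implied): for the real map-assisted tempering hub the two numbers an experiment needs — how long
to discard and how many sweeps to average — are explicit in `K`, `m`, `c`, the swap fraction `t`, the domination
constant `p` of the learned transport and `Var_π̃(f)`: order `(K/p)·log(K/(pε))` burn-in and order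
`(K/p)·Var(f)/(η²ε)` samples at `m = cK`; the estimator is the plain ergodic average of the exact
(Metropolis-corrected) chain, so it is unbiased in the limit and the bound is an honest confidence statement, not an
effective-sample-size heuristic.  NOT CLAIMED: Chebyshev-level constants only (no exponential concentration);
anything outside the regime `4t ≤ p(1−t)w_0` for imperfect maps; anything measured.  Literature grade (cell rule):
OWN RESULT on the tree's Levin–Peres–Wilmer Theorem 12.21 (`LevinPeres2017_thm_12_21`); nothing cited as a fact; no
new bib keys.
-/

noncomputable section

open Finset Function
open Literature.Probability.MarkovChains

namespace Summit.Ventures.LatticeQCDFlow.Scaling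

/-! ## §0 Irreducibility from an everywhere-positive power -/

/-- **`Pⁿ(x,z) > 0` for all `x, z` at one time `n` ⇒ `P` irreducible.** [ours] -/
theorem isIrreducible_of_kernelAt_pos {X : Type*} [Fintype X] [DecidableEq X] {P : Matrix X X ℝ} {n : ℕ}
    (h : ∀ x z, 0 < kernelAt P n x z) : Literature.Probability.MarkovChains.IsIrreducible P :=
  fun x z => ⟨n, by rw [← kernelAt_eq_pow_apply P n x z]; exact h x z⟩

variable {S : Type*} [Fintype S] [DecidableEq S] {K m : ℕ} {μ : Fin (K + 1) → S → ℝ} {M : Fin (K + 1) → S → S → ℝ}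
  {w : Fin (K + 1) → ℝ} {t p : ℝ}

section Avg
variable (κ : Fin m → Fin K) (φ : Fin m → Equiv.Perm S)

/-! ## §1 Irreducibility and the variational spectral gap -/

/-- **THE SCHEME IS IRREDUCIBLE** under one-sided domination, `4t ≤ p(1−t)w_0`, `0 < t`, exact hot sampler,
reversible cold kernels, hub multiplicities `≥ c ≥ 1`: some power of `P` is everywhere positive. [ours] -/
theorem dominatedStar_isIrreducible (hm : 1 ≤ m) (ht0 : 0 < t) (ht1 : t ≤ 1) (hw0 : ∀ k, 0 ≤ w k)
    (hw1 : ∑ k, w k = 1) (hμ : ∀ k x, 0 < μ k x) (hμ1 : ∀ k, ∑ u, μ k u = 1) (hM : ∀ k, IsRowStochastic (M k))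
    (hMrev : ∀ k, DetailedBalance (μ k) (M k)) (hM0 : ∀ u v, M 0 u v = μ 0 v) (hp0 : 0 < p) (hp1 : p ≤ 1)
    (hdom : ∀ r u, p * μ (κ r).succ (φ r u) ≤ μ 0 u) (hreg : 4 * t ≤ p * (1 - t) * w 0)
    {c : ℕ} (hc1 : 1 ≤ c) (hc : ∀ p' : Fin K, c ≤ (univ.filter (fun r : Fin m => κ r = p')).card) (hcm : c ≤ m) :
    Literature.Probability.MarkovChains.IsIrreducible (fun y z : Fin (K + 1) → S =>
        t * ptGraphSwap μ (fun r : Fin m => (((0 : Fin (K + 1)), (κ r).succ) : Fin (K + 1) × Fin (K + 1))) φ y z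
          + (1 - t) * prodKernel w M y z) := by
  have hstat : ∀ k : Fin (K + 1), k ≠ 0 → ∀ v, ∑ u, μ k u * M k u v = μ k v :=
    fun k _ v => (hMrev k).isStationary (hM k).2 v
  have hmpos : (0 : ℝ) < m := Nat.cast_pos.mpr (by omega)
  have hcpos : (0 : ℝ) < c := Nat.cast_pos.mpr (by omega)
  have hKp : 0 < 2 * (K : ℝ) + p := by positivity
  -- a time `n` with `((2K+p)/p)·ρⁿ < 1`
  have hρ1 : 1 - t * c * p / (2 * m) < 1 := by
    have : 0 < t * c * p / (2 * m) := by positivity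
    linarith
  obtain ⟨n, hn⟩ := exists_pow_lt_of_lt_one (div_pos hp0 hKp) hρ1
  have hlt : (2 * (K : ℝ) + p) / p * (1 - t * c * p / (2 * m)) ^ n < 1 := by
    have h1 := mul_lt_mul_of_pos_left hn (div_pos hKp hp0)
    have e : (2 * (K : ℝ) + p) / p * (p / (2 * (K : ℝ) + p)) = 1 := by
      field_simp
    rwa [e] at h1
  refine isIrreducible_of_kernelAt_pos (n := n) fun x z => ?_
  have hge := dominatedStar_kernelAt_ge κ φ hm ht0.le ht1 hw0 hw1 hμ hμ1 hM hM0 hstat hp0 hp1 hdom hreg hc1 hc hcm n x z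
  exact lt_of_lt_of_le (mul_pos (by linarith) (tensorFun_pos hμ z)) hge

/-- **THE VARIATIONAL SPECTRAL GAP: `γ ≥ tcp/(2m)`** (`|S| ≥ 2`; `γ = 1 − λ₂ ≥ γ⋆` for the irreducible reversible
scheme, and `γ⋆ ≥ tcp/(2m)` by `Scaling/DominatedStarGapAndMixing`). [ours] -/
theorem dominatedStar_spectralGap_ge [Nontrivial S] (hm : 1 ≤ m) (ht0 : 0 < t) (ht1 : t ≤ 1) (hw0 : ∀ k, 0 ≤ w k)
    (hw1 : ∑ k, w k = 1) (hμ : ∀ k x, 0 < μ k x) (hμ1 : ∀ k, ∑ u, μ k u = 1) (hM : ∀ k, IsRowStochastic (M k))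
    (hMrev : ∀ k, DetailedBalance (μ k) (M k)) (hM0 : ∀ u v, M 0 u v = μ 0 v) (hp0 : 0 < p) (hp1 : p ≤ 1)
    (hdom : ∀ r u, p * μ (κ r).succ (φ r u) ≤ μ 0 u) (hreg : 4 * t ≤ p * (1 - t) * w 0)
    {c : ℕ} (hc1 : 1 ≤ c) (hc : ∀ p' : Fin K, c ≤ (univ.filter (fun r : Fin m => κ r = p')).card) (hcm : c ≤ m) :
    t * c * p / (2 * m) ≤ spectralGap (tensorFun μ) (fun y z : Fin (K + 1) → S =>
        t * ptGraphSwap μ (fun r : Fin m => (((0 : Fin (K + 1)), (κ r).succ) : Fin (K + 1) × Fin (K + 1))) φ y z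
          + (1 - t) * prodKernel w M y z) := by
  have hP := weightedScheme_isRowStochastic (t := t) (w := w)
    (ptGraphSwap_isRowStochastic (e := fun r : Fin m => (((0 : Fin (K + 1)), (κ r).succ) : Fin (K + 1) × Fin (K + 1)))
      (φ := φ) hμ) hM hw0 hw1 ht0.le ht1
  exact (dominatedStar_absSpectralGap_ge κ φ hm ht0.le ht1 hw0 hw1 hμ hμ1 hM hMrev hM0 hp0 hp1 hdom hreg hc1 hc hcm).trans
    (absSpectralGap_le_spectralGap (fun z => tensorFun_pos hμ z) (sum_tensorFun_eq_one _ hμ1) hP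
      (dominatedStar_detailedBalance κ φ hμ hMrev)
      (dominatedStar_isIrreducible κ φ hm ht0 ht1 hw0 hw1 hμ hμ1 hM hMrev hM0 hp0 hp1 hdom hreg hc1 hc hcm))

/-- **`γ⁻¹ ≤ 2m/(tcp)`** (`|S| ≥ 2`). [ours] -/
theorem dominatedStar_spectralGap_inv_le [Nontrivial S] (hm : 1 ≤ m) (ht0 : 0 < t) (ht1 : t ≤ 1)
    (hw0 : ∀ k, 0 ≤ w k) (hw1 : ∑ k, w k = 1) (hμ : ∀ k x, 0 < μ k x) (hμ1 : ∀ k, ∑ u, μ k u = 1)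
    (hM : ∀ k, IsRowStochastic (M k)) (hMrev : ∀ k, DetailedBalance (μ k) (M k)) (hM0 : ∀ u v, M 0 u v = μ 0 v)
    (hp0 : 0 < p) (hp1 : p ≤ 1) (hdom : ∀ r u, p * μ (κ r).succ (φ r u) ≤ μ 0 u) (hreg : 4 * t ≤ p * (1 - t) * w 0)
    {c : ℕ} (hc1 : 1 ≤ c) (hc : ∀ p' : Fin K, c ≤ (univ.filter (fun r : Fin m => κ r = p')).card) (hcm : c ≤ m) :
    (spectralGap (tensorFun μ) (fun y z : Fin (K + 1) → S =>
        t * ptGraphSwap μ (fun r : Fin m => (((0 : Fin (K + 1)), (κ r).succ) : Fin (K + 1) × Fin (K + 1))) φ y z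
          + (1 - t) * prodKernel w M y z))⁻¹ ≤ 2 * m / (t * c * p) := by
  have hmpos : (0 : ℝ) < m := Nat.cast_pos.mpr (by omega)
  have hcpos : (0 : ℝ) < c := Nat.cast_pos.mpr (by omega)
  have hpos : 0 < t * c * p / (2 * m) := by positivity
  have h := inv_anti₀ hpos (dominatedStar_spectralGap_ge κ φ hm ht0 ht1 hw0 hw1 hμ hμ1 hM hMrev hM0 hp0 hp1 hdom hreg
    hc1 hc hcm)
  rwa [inv_div] at h

/-! ## §2 The sample-size rule -/

/-- **THE SAMPLE-SIZE RULE FOR THE MAP-ASSISTED HOT-REFRESHED HUB** (`|S| ≥ 2`): for every observable `f` of the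
configuration and `ε, η > 0`, a burn-in `r ≥ ⌈(2m/(tcp))·log((2K+p)/(p·(ε/2)))⌉` and a sample size `N ≥ 1` with
`N ≥ (4Var_π̃(f)/(η²ε))·(2m/(tcp))` give, from EVERY start `x`,
**`P_x{|N⁻¹ Σ_{s<N} f(X_{r+s}) − E_π̃(f)| ≥ η} ≤ ε`** — the left side is the `pathSum P (N + r) x`-expectation of the
indicator of the event, read on the window `X_r, …, X_{r+N−1}` of the trajectory `(X_0, …, X_{N+r})` started at
`X_0 = x` (the form of the tree's `LevinPeres2017_thm_12_21`). [ours] -/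
theorem dominatedStar_timeAverage [Nontrivial S] (hm : 1 ≤ m) (ht0 : 0 < t) (ht1 : t ≤ 1) (hw0 : ∀ k, 0 ≤ w k)
    (hw1 : ∑ k, w k = 1) (hμ : ∀ k x, 0 < μ k x) (hμ1 : ∀ k, ∑ u, μ k u = 1) (hM : ∀ k, IsRowStochastic (M k))
    (hMrev : ∀ k, DetailedBalance (μ k) (M k)) (hM0 : ∀ u v, M 0 u v = μ 0 v) (hp0 : 0 < p) (hp1 : p ≤ 1)
    (hdom : ∀ r u, p * μ (κ r).succ (φ r u) ≤ μ 0 u) (hreg : 4 * t ≤ p * (1 - t) * w 0)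
    {c : ℕ} (hc1 : 1 ≤ c) (hc : ∀ p' : Fin K, c ≤ (univ.filter (fun r : Fin m => κ r = p')).card) (hcm : c ≤ m)
    (f : (Fin (K + 1) → S) → ℝ) {ε η : ℝ} (hε : 0 < ε) (hη : 0 < η) {r N : ℕ}
    (hr : ⌈2 * (m : ℝ) / (t * c * p) * Real.log ((2 * (K : ℝ) + p) / (p * (ε / 2)))⌉₊ ≤ r) (hN : 0 < N)
    (hNvar : 4 * lawVariance (tensorFun μ) f / (η ^ 2 * ε) * (2 * m / (t * c * p)) ≤ N) (x : Fin (K + 1) → S) :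
    pathSum (fun y z : Fin (K + 1) → S =>
        t * ptGraphSwap μ (fun r : Fin m => (((0 : Fin (K + 1)), (κ r).succ) : Fin (K + 1) × Fin (K + 1))) φ y z
          + (1 - t) * prodKernel w M y z) (N + r) x (fun ω =>
        if η ≤ |(∑ s : Fin N, f ((Matrix.vecCons x ω : Fin (N + r + 1) → (Fin (K + 1) → S))
              ⟨(s : ℕ) + r, by have := s.isLt; omega⟩)) / N - lawMean (tensorFun μ) f|
          then (1 : ℝ) else 0) ≤ ε := by
  have hstat : ∀ k : Fin (K + 1), k ≠ 0 → ∀ v, ∑ u, μ k u * M k u v = μ k v :=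
    fun k _ v => (hMrev k).isStationary (hM k).2 v
  have hmpos : (0 : ℝ) < m := Nat.cast_pos.mpr (by omega)
  have hcpos : (0 : ℝ) < c := Nat.cast_pos.mpr (by omega)
  have hP := weightedScheme_isRowStochastic (t := t) (w := w)
    (ptGraphSwap_isRowStochastic (e := fun r : Fin m => (((0 : Fin (K + 1)), (κ r).succ) : Fin (K + 1) × Fin (K + 1)))
      (φ := φ) hμ) hM hw0 hw1 ht0.le ht1
  have hDB := dominatedStar_detailedBalance κ φ (t := t) (w := w) hμ hMrev
  have hirr := dominatedStar_isIrreducible κ φ hm ht0 ht1 hw0 hw1 hμ hμ1 hM hMrev hM0 hp0 hp1 hdom hreg hc1 hc hcm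
  have hε2 : 0 < ε / 2 := by linarith
  have ht₀ := dominatedStar_worstTvDist_le_of_ge_log κ φ hm ht0 ht1 hw0 hw1 hμ hμ1 hM hM0 hstat hp0 hp1 hdom hreg hc1 hc
    hcm hε2 (Nat.le_ceil (2 * (m : ℝ) / (t * c * p) * Real.log ((2 * (K : ℝ) + p) / (p * (ε / 2)))))
  have hmix := (dominatedStar_mixingTime_le κ φ hm ht0 ht1 hw0 hw1 hμ hμ1 hM hM0 hstat hp0 hp1 hdom hreg hc1 hc hcm
    hε2).trans hr
  have hγ := dominatedStar_spectralGap_inv_le κ φ hm ht0 ht1 hw0 hw1 hμ hμ1 hM hMrev hM0 hp0 hp1 hdom hreg hc1 hc hcm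
  have hV : 0 ≤ 4 * lawVariance (tensorFun μ) f / (η ^ 2 * ε) :=
    div_nonneg (mul_nonneg (by norm_num) (lawVariance_nonneg (fun z => (tensorFun_pos hμ z).le) f)) (by positivity)
  have hNγ : 4 * lawVariance (tensorFun μ) f / (η ^ 2 * ε) * (spectralGap (tensorFun μ)
      (fun y z : Fin (K + 1) → S =>
        t * ptGraphSwap μ (fun r : Fin m => (((0 : Fin (K + 1)), (κ r).succ) : Fin (K + 1) × Fin (K + 1))) φ y z
          + (1 - t) * prodKernel w M y z))⁻¹ ≤ N :=
    (mul_le_mul_of_nonneg_left hγ hV).trans hNvar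
  exact LevinPeres2017_thm_12_21 (fun z => tensorFun_pos hμ z) (sum_tensorFun_eq_one _ hμ1) hP hDB hirr f hε hη ht₀
    hmix hN hNγ x

end Avg

end Summit.Ventures.LatticeQCDFlow.Scaling

end
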